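import Mathlib
import Literature.Analysis.FunctionSpaces.PlancherelL1L2

/-!
# v6 «SuzukiWindowsDoorConverse» — L5: the weighted contraction bound via Plancherel

RH-FREE, ζ-FREE harmonic analysis.  For a continuous kernel `K` vanishing on `(−∞,0)` with growth
`|K| ≤ D_δ e^{4δ·}` (all small `δ`), Laplace identity `∫ K e^{iz·} = Θ(z)` and `‖Θ(z)‖ ≤ 1` on `ℂ₊`, every
`f ∈ L²(−t,t)` and every `c ∈ (0, 1/2]` satisfy, with `g(x) = ∫_{(−t,t)} K(x+y) f(y) dy`,
`∫_ℝ g(x)² e^{−2cx} dx ≤ ∫_{(−t,t)} f(y)² e^{2cy} dy`  (Plancherel on the line `Im z = c`, where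
`𝓕[g e^{−c·}](w) = Θ(−2πw + ic) · 𝓕[1_{(−t,t)} f e^{c·}](−w)`).  Nothing here bears on the truth of RH.
-/

set_option linter.dupNamespace false

open MeasureTheory Set Filter Complex Topology FourierTransform

namespace Summit.RiemannHypothesis.RiemannHypothesis.Theorems.SuzukiWindowsDoorConverse

/-- `L¹ ∩ L²` from an exponential majorant: `W = 0` on `(−∞,−T)`, `‖W x‖ ≤ D e^{−a x}` for `x ≥ −T`, `a > 0`. -/
theorem integrable_and_memLp_of_expDecay' {E : Type*} [NormedAddCommGroup E] {W : ℝ → E}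
    (hWm : AEStronglyMeasurable W volume) {T : ℝ} (hW0 : ∀ x : ℝ, x < -T → W x = 0)
    {D a : ℝ} (ha : 0 < a) (hD : ∀ x : ℝ, -T ≤ x → ‖W x‖ ≤ D * Real.exp (-a * x)) :
    Integrable W ∧ MemLp W 2 volume := by
  have hD0 : 0 ≤ D := by
    have h := hD (-T) le_rfl
    exact le_of_mul_le_mul_right ((norm_nonneg _).trans h |>.trans_eq' (by ring)) (Real.exp_pos _)
  set g : ℝ → ℝ := (Ici (-T)).indicator fun x => D * Real.exp (-a * x) with hg_def
  have hg_nonneg : ∀ x, 0 ≤ g x := fun x => by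
    simp only [hg_def]; exact Set.indicator_nonneg (fun y _ => by positivity) _
  have hgm : AEStronglyMeasurable g volume := by
    refine AEStronglyMeasurable.indicator ?_ measurableSet_Ici
    exact (continuous_const.mul (Real.continuous_exp.comp (continuous_const.mul continuous_id))).aestronglyMeasurable
  have hg1 : Integrable g := by
    rw [hg_def, integrable_indicator_iff measurableSet_Ici, integrableOn_Ici_iff_integrableOn_Ioi]
    exact (exp_neg_integrableOn_Ioi (-T) ha).const_mul D
  have hg2 : MemLp g 2 volume := by
    rw [memLp_two_iff_integrable_sq hgm]
    have hsq : (fun x => g x ^ 2) = (Ici (-T)).indicator fun x => D ^ 2 * Real.exp (-(2 * a) * x) := by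
      funext x
      by_cases hx : x ∈ Ici (-T)
      · simp only [hg_def, indicator_of_mem hx, mul_pow, ← Real.exp_nat_mul]; ring_nf
      · simp only [hg_def, indicator_of_notMem hx]; ring
    rw [hsq, integrable_indicator_iff measurableSet_Ici, integrableOn_Ici_iff_integrableOn_Ioi]
    exact (exp_neg_integrableOn_Ioi (-T) (by linarith)).const_mul _
  have hdom : ∀ x : ℝ, ‖W x‖ ≤ ‖g x‖ := by
    intro x
    rw [Real.norm_of_nonneg (hg_nonneg x)]
    by_cases hx : x ∈ Ici (-T)
    · rw [hg_def, indicator_of_mem hx]; exact hD x hx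
    · have hx' : x < -T := by simpa using hx
      rw [hW0 x hx', norm_zero]; exact hg_nonneg x
  exact ⟨hg1.mono' hWm (Eventually.of_forall fun x => by simpa [Real.norm_of_nonneg (hg_nonneg x)] using hdom x),
    hg2.of_le hWm (Eventually.of_forall hdom)⟩

/-- RH-FREE (L5): the WEIGHTED CONTRACTION BOUND on the line `Im z = c`. -/
theorem weighted_contraction {K : ℝ → ℝ} (hKc : Continuous K) (hK0 : ∀ x : ℝ, x < 0 → K x = 0)
    {Θ : ℂ → ℂ} (hΘ : ∀ z : ℂ, 0 < z.im → ‖Θ z‖ ≤ 1)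
    (hGrowth : ∀ δ : ℝ, 0 < δ → δ ≤ 1 / 16 → ∃ D : ℝ, ∀ x : ℝ, |K x| ≤ D * Real.exp (4 * δ * x))
    -- the Fubini identity and the continuity of the window transform (module FubiniWindow), as inputs:
    (hFub : ∀ z : ℂ, 0 < z.im → ∀ (t : ℝ) (f : ℝ → ℝ), MemLp f 2 (volume.restrict (Ioo (-t) t)) →
      Integrable (fun x : ℝ => ((∫ y in Ioo (-t) t, K (x + y) * f y : ℝ) : ℂ) * Complex.exp (I * z * (x : ℂ))) ∧
      ∫ x : ℝ, ((∫ y in Ioo (-t) t, K (x + y) * f y : ℝ) : ℂ) * Complex.exp (I * z * (x : ℂ)) =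
        Θ z * ∫ y in Ioo (-t) t, (f y : ℂ) * Complex.exp (-(I * z * (y : ℂ))))
    (hCont : ∀ (t : ℝ) (f : ℝ → ℝ), MemLp f 2 (volume.restrict (Ioo (-t) t)) →
      Continuous fun x : ℝ => ∫ y in Ioo (-t) t, K (x + y) * f y)
    {t : ℝ} {f : ℝ → ℝ} (hf : MemLp f 2 (volume.restrict (Ioo (-t) t)))
    {c : ℝ} (hc : 0 < c) (hc1 : c ≤ 1 / 2) :
    Integrable (fun x : ℝ => (∫ y in Ioo (-t) t, K (x + y) * f y) ^ 2 * Real.exp (-(2 * c) * x)) ∧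
      ∫ x : ℝ, (∫ y in Ioo (-t) t, K (x + y) * f y) ^ 2 * Real.exp (-(2 * c) * x) ≤
        ∫ y in Ioo (-t) t, f y ^ 2 * Real.exp (2 * c * y) := by
  set s : Set ℝ := Ioo (-t) t with hs_def
  have hs : MeasurableSet s := measurableSet_Ioo
  haveI : IsFiniteMeasure (volume.restrict s) := by rw [hs_def]; infer_instance
  have hf1 : Integrable f (volume.restrict s) := hf.integrable one_le_two
  set g : ℝ → ℝ := fun x => ∫ y in s, K (x + y) * f y with hg_def
  have hgc : Continuous g := hCont t f hf
  -- growth at rate c/2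
  obtain ⟨D, hD⟩ := hGrowth (c / 8) (by positivity) (by linarith)
  have hD0 : 0 ≤ D := by
    have h := hD 0; simp only [mul_zero, Real.exp_zero, mul_one] at h; exact (abs_nonneg _).trans h
  have hrate : ∀ x, 4 * (c / 8) * x = c / 2 * x := fun x => by ring
  simp_rw [hrate] at hD
  -- g vanishes on (−∞, −t] and |g x| ≤ D e^{(c/2)(x+|t|)} A
  set A : ℝ := ∫ y in s, |f y| with hA_def
  have hA0 : 0 ≤ A := setIntegral_nonneg hs fun y _ => abs_nonneg _
  have hg0 : ∀ x : ℝ, x < -t → g x = 0 := by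
    intro x hx
    simp only [hg_def]
    refine setIntegral_eq_zero_of_forall_eq_zero fun y hy => ?_
    rw [hK0 (x + y) (by have := hy.2; linarith), zero_mul]
  have hgb : ∀ x : ℝ, |g x| ≤ D * Real.exp (c / 2 * (x + |t|)) * A := by
    intro x
    have hKbd : ∀ y ∈ s, |K (x + y)| ≤ D * Real.exp (c / 2 * (x + |t|)) := by
      intro y hy
      refine (hD (x + y)).trans (mul_le_mul_of_nonneg_left (Real.exp_le_exp.2 ?_) hD0)
      have : y ≤ |t| := by have := le_abs_self t; have := hy.2; linarith
      nlinarith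
    have hKf : Integrable (fun y => K (x + y) * f y) (volume.restrict s) := by
      refine hf1.bdd_mul (c := D * Real.exp (c / 2 * (x + |t|)))
        (hKc.comp (continuous_const.add continuous_id)).aestronglyMeasurable ?_
      filter_upwards [ae_restrict_mem hs] with y hy
      rw [Real.norm_eq_abs]; exact hKbd y hy
    calc |g x| = |∫ y in s, K (x + y) * f y| := rfl
      _ ≤ ∫ y in s, |K (x + y) * f y| := abs_integral_le_integral_abs
      _ ≤ ∫ y in s, D * Real.exp (c / 2 * (x + |t|)) * |f y| := by
          refine setIntegral_mono_on hKf.abs (hf1.abs.const_mul _) hs fun y hy => ?_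
          rw [abs_mul]; exact mul_le_mul_of_nonneg_right (hKbd y hy) (abs_nonneg _)
      _ = D * Real.exp (c / 2 * (x + |t|)) * A := integral_const_mul _ _
  -- the damped output `gc = g e^{-c·}` (complex-valued) is in L¹ ∩ L²
  set gc : ℝ → ℂ := fun x => ((g x * Real.exp (-(c * x)) : ℝ) : ℂ) with hgc_def
  have hgcm : AEStronglyMeasurable gc volume :=
    (Complex.continuous_ofReal.comp (hgc.mul (Real.continuous_exp.comp
      ((continuous_const.mul continuous_id).neg)))).aestronglyMeasurable
  have hgc_norm : ∀ x : ℝ, ‖gc x‖ = |g x| * Real.exp (-(c * x)) := by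
    intro x; simp only [hgc_def, Complex.norm_real, Real.norm_eq_abs, abs_mul, abs_of_pos (Real.exp_pos _)]
  have hgc12 : Integrable gc ∧ MemLp gc 2 volume := by
    refine integrable_and_memLp_of_expDecay' hgcm (T := t) (fun x hx => by simp [hgc_def, hg0 x hx])
      (a := c / 2) (D := D * Real.exp (c / 2 * |t|) * A) (by positivity) fun x _ => ?_
    rw [hgc_norm]
    calc |g x| * Real.exp (-(c * x)) ≤ D * Real.exp (c / 2 * (x + |t|)) * A * Real.exp (-(c * x)) :=
          mul_le_mul_of_nonneg_right (hgb x) (Real.exp_pos _).le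
      _ = D * Real.exp (c / 2 * |t|) * A * Real.exp (-(c / 2) * x) := by
          have : Real.exp (c / 2 * (x + |t|)) * Real.exp (-(c * x)) =
              Real.exp (c / 2 * |t|) * Real.exp (-(c / 2) * x) := by
            rw [← Real.exp_add, ← Real.exp_add]; ring_nf
          calc D * Real.exp (c / 2 * (x + |t|)) * A * Real.exp (-(c * x))
              = D * A * (Real.exp (c / 2 * (x + |t|)) * Real.exp (-(c * x))) := by ring
            _ = D * A * (Real.exp (c / 2 * |t|) * Real.exp (-(c / 2) * x)) := by rw [this]
            _ = D * Real.exp (c / 2 * |t|) * A * Real.exp (-(c / 2) * x) := by ring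
  -- the weighted input `fc = 1_s f e^{c·}` (complex-valued) is in L¹ ∩ L²
  set fc : ℝ → ℂ := s.indicator (fun y => ((f y * Real.exp (c * y) : ℝ) : ℂ)) with hfc_def
  have hFm : AEStronglyMeasurable (fun y => ((f y * Real.exp (c * y) : ℝ) : ℂ)) (volume.restrict s) :=
    Complex.continuous_ofReal.comp_aestronglyMeasurable (hf.1.mul (by fun_prop))
  have hFbd : ∀ᵐ y ∂(volume.restrict s), ‖((f y * Real.exp (c * y) : ℝ) : ℂ)‖ ≤ ‖Real.exp (c * |t|) * ‖f y‖‖ := by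
    filter_upwards [ae_restrict_mem hs] with y hy
    rw [Complex.norm_real, Real.norm_eq_abs, abs_mul, abs_of_pos (Real.exp_pos _), Real.norm_of_nonneg
      (by positivity), Real.norm_eq_abs, mul_comm]
    refine mul_le_mul_of_nonneg_right (Real.exp_le_exp.2 ?_) (abs_nonneg _)
    have : y ≤ |t| := by have := le_abs_self t; have := hy.2; linarith
    nlinarith
  have hfcR2 : MemLp (fun y => ((f y * Real.exp (c * y) : ℝ) : ℂ)) 2 (volume.restrict s) :=
    (hf.norm.const_mul (Real.exp (c * |t|))).of_le hFm hFbd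
  have hfcR1 : Integrable (fun y => ((f y * Real.exp (c * y) : ℝ) : ℂ)) (volume.restrict s) :=
    hfcR2.integrable one_le_two
  have hfc1 : Integrable fc := by rw [hfc_def, integrable_indicator_iff hs]; exact hfcR1
  have hfc2 : MemLp fc 2 volume := by rw [hfc_def, memLp_indicator_iff_restrict hs]; exact hfcR2
  -- the line Im z = c, parametrised by the Fourier variable w
  set zl : ℝ → ℂ := fun w => ((-2 * Real.pi * w : ℝ) : ℂ) + (c : ℂ) * I with hzl_def
  have hzl_im : ∀ w, (zl w).im = c := fun w => by simp [hzl_def]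
  have hzl_pos : ∀ w, 0 < (zl w).im := fun w => by rw [hzl_im]; exact hc
  -- (i) 𝓕 gc w = ∫ g(x) e^{i zl(w) x} dx
  have hFg : ∀ w : ℝ, 𝓕 gc w = ∫ x : ℝ, (g x : ℂ) * Complex.exp (I * zl w * (x : ℂ)) := by
    intro w
    rw [Real.fourier_real_eq_integral_exp_smul]
    refine integral_congr_ae (Eventually.of_forall fun v => ?_)
    simp only [hgc_def, smul_eq_mul, Complex.ofReal_mul, Complex.ofReal_exp]
    rw [mul_left_comm, ← Complex.exp_add]
    congr 2
    simp only [hzl_def]; push_cast; ring_nf; rw [I_sq]; ring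
  -- (iii) the f-side: ∫_s f(y) e^{-i zl(w) y} dy = 𝓕 fc (-w)
  have hFf : ∀ w : ℝ, ∫ y in s, (f y : ℂ) * Complex.exp (-(I * zl w * (y : ℂ))) = 𝓕 fc (-w) := by
    intro w
    rw [Real.fourier_real_eq_integral_exp_smul]
    have : (fun v : ℝ => Complex.exp (((-2 * Real.pi * v * (-w) : ℝ) : ℂ) * I) • fc v) =
        s.indicator (fun v : ℝ => Complex.exp (((-2 * Real.pi * v * (-w) : ℝ) : ℂ) * I) *
          ((f v * Real.exp (c * v) : ℝ) : ℂ)) := by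
      funext v; by_cases hv : v ∈ s <;> simp [hfc_def, hv, smul_eq_mul]
    rw [this, integral_indicator hs]
    refine integral_congr_ae (Eventually.of_forall fun v => ?_)
    simp only [Complex.ofReal_mul, Complex.ofReal_exp]
    symm
    rw [mul_left_comm, ← Complex.exp_add]
    congr 2
    simp only [hzl_def]; push_cast; ring_nf; rw [I_sq]; ring
  -- (iv) pointwise domination of the transforms
  have hdomF : ∀ w : ℝ, ‖𝓕 gc w‖ ≤ ‖𝓕 fc (-w)‖ := by
    intro w
    rw [hFg w, (hFub (zl w) (hzl_pos w) t f hf).2, hFf w, norm_mul]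
    calc ‖Θ (zl w)‖ * ‖𝓕 fc (-w)‖ ≤ 1 * ‖𝓕 fc (-w)‖ :=
          mul_le_mul_of_nonneg_right (hΘ _ (hzl_pos w)) (norm_nonneg _)
      _ = ‖𝓕 fc (-w)‖ := one_mul _
  -- (v) Plancherel twice
  have hPg := Literature.Analysis.FunctionSpaces.integral_norm_sq_fourierIntegral_eq hgc12.1 hgc12.2
  have hPf := Literature.Analysis.FunctionSpaces.integral_norm_sq_fourierIntegral_eq hfc1 hfc2
  have hFf2 : MemLp (𝓕 fc) 2 (volume : Measure ℝ) :=
    Literature.Analysis.FunctionSpaces.memLp_two_fourierIntegral hfc1 hfc2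
  have hFg2 : MemLp (𝓕 gc) 2 (volume : Measure ℝ) :=
    Literature.Analysis.FunctionSpaces.memLp_two_fourierIntegral hgc12.1 hgc12.2
  have hIf : Integrable (fun w : ℝ => ‖𝓕 fc w‖ ^ 2) := (memLp_two_iff_integrable_sq_norm hFf2.1).1 hFf2
  have hIfneg : Integrable (fun w : ℝ => ‖𝓕 fc (-w)‖ ^ 2) :=
    ((Measure.measurePreserving_neg (volume : Measure ℝ)).integrable_comp hIf.aestronglyMeasurable).2 hIf
  have hIg : Integrable (fun w : ℝ => ‖𝓕 gc w‖ ^ 2) := (memLp_two_iff_integrable_sq_norm hFg2.1).1 hFg2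
  have hmono : ∫ w : ℝ, ‖𝓕 gc w‖ ^ 2 ≤ ∫ w : ℝ, ‖𝓕 fc (-w)‖ ^ 2 :=
    integral_mono hIg hIfneg fun w => by
      have := hdomF w
      exact pow_le_pow_left₀ (norm_nonneg _) this 2
  have hneg : ∫ w : ℝ, ‖𝓕 fc (-w)‖ ^ 2 = ∫ w : ℝ, ‖𝓕 fc w‖ ^ 2 :=
    integral_neg_eq_self (fun w : ℝ => ‖𝓕 fc w‖ ^ 2) volume
  -- (vi) identify the two sides
  have hsqpt : ∀ x : ℝ, ‖gc x‖ ^ 2 = g x ^ 2 * Real.exp (-(2 * c) * x) := by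
    intro x
    rw [hgc_norm, mul_pow, sq_abs, ← Real.exp_nat_mul]; ring_nf
  have hL : ∫ x : ℝ, ‖gc x‖ ^ 2 = ∫ x : ℝ, g x ^ 2 * Real.exp (-(2 * c) * x) :=
    integral_congr_ae (Eventually.of_forall fun x => hsqpt x)
  have hR : ∫ y : ℝ, ‖fc y‖ ^ 2 = ∫ y in s, f y ^ 2 * Real.exp (2 * c * y) := by
    have : (fun y : ℝ => ‖fc y‖ ^ 2) = s.indicator (fun y => f y ^ 2 * Real.exp (2 * c * y)) := by
      funext y
      by_cases hy : y ∈ s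
      · simp only [hfc_def, indicator_of_mem hy, Complex.norm_real, Real.norm_eq_abs, abs_mul,
          abs_of_pos (Real.exp_pos _), mul_pow, sq_abs, ← Real.exp_nat_mul]; ring_nf
      · simp only [hfc_def, indicator_of_notMem hy, norm_zero]; ring
    rw [this, integral_indicator hs]
  have hgsq : Integrable (fun x : ℝ => g x ^ 2 * Real.exp (-(2 * c) * x)) := by
    have h := (memLp_two_iff_integrable_sq_norm hgcm).1 hgc12.2
    exact h.congr (Eventually.of_forall fun x => hsqpt x)
  refine ⟨hgsq, ?_⟩
  calc ∫ x : ℝ, g x ^ 2 * Real.exp (-(2 * c) * x) = ∫ x : ℝ, ‖gc x‖ ^ 2 := hL.symm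
    _ = ∫ w : ℝ, ‖𝓕 gc w‖ ^ 2 := hPg.symm
    _ ≤ ∫ w : ℝ, ‖𝓕 fc (-w)‖ ^ 2 := hmono
    _ = ∫ w : ℝ, ‖𝓕 fc w‖ ^ 2 := hneg
    _ = ∫ y : ℝ, ‖fc y‖ ^ 2 := hPf
    _ = ∫ y in s, f y ^ 2 * Real.exp (2 * c * y) := hR

end Summit.RiemannHypothesis.RiemannHypothesis.Theorems.SuzukiWindowsDoorConverse
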